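import Summits.QuantumFields.QCD.Theorems.WindowExtinction.Negative.CoercivityDefectNearRoot
import Summits.QuantumFields.QCD.Theorems.SpectralDefectExtinctionWindowExtinctionFluxTransportHJL
import Literature.MathematicalPhysics.QuantumLattice.OverlapLocality
import Literature.MathematicalPhysics.QuantumFieldTheory.QCDPhaseQuenched
import HarnessLib

/-!
# Stub `stub_transportOfGap` of line `hermitian-flow-coarea` (reshape r6): transport of the negative count of
# `Γ₅ D_W(U,−δ,1)` from the overlap point `δ = 1` over the PROVED Hernández–Jansen–Lüscher gap

Crux `Summit.QuantumFields.QCD.Theses.SpectralDefectExtinction.TipPricing` (item stmt-QuantumFields-8967), line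
`hermitian-flow-coarea`, lead c4.  This file is the mechanical port of the sibling crux 8964's helper
`flux_transport_of_HJL` (`Theorems/SpectralDefectExtinctionWindowExtinctionFluxTransportHJL.lean`, namespace
`Summit.QuantumFields.QCD.Cruxes.WindowExtinction.FreeVolumeHeavyWitness`) with its hypothesis — the whole named fact
`HJLLocality (fundamentalRep (Fin 3))` — replaced by the ONLY conjunct that proof consumes, the gap
`(1 − 30ε) Σ_i ‖ψ_i‖² ≤ Σ_i ‖(D_W(U,−1,1)ψ)_i‖²` for `ε`-norm-admissible `SU(3)` fields (HJL 1999 (2.16)), which is a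
theorem of the tree (stub `stub_hjlGap` of the same line, Neuberger's lower bound).  Given that gap as a hypothesis,
for a norm-admissible field `U` with `0 < lo`, `30ε < lo²` and every `δ ∈ [lo, 1]`:

* `transportGap_mulVec_eq_zero` — `D_W(U,−δ,1)` is injective: a kernel vector `ψ` has `D_W(U,−1,1)ψ = (δ − 1)ψ`
  (`fluxHJL_wilsonDirac_neg_eq`, reused), so the gap gives `(1 − 30ε)‖ψ‖² ≤ (1 − δ)²‖ψ‖²`, impossible for `ψ ≠ 0`
  since `(1 − δ)² ≤ 1 − δ ≤ 1 − lo ≤ 1 − lo² < 1 − 30ε`;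
* `transportGap_no_realMode` — hence the massless operator `D_W(U,0,1)` has no real characteristic root in
  `[lo, 1]` (an eigenvector of a real root `μ` lies in the kernel of `D_W(U,−μ,1)`);
* `stub_transportOfGap` — the REGISTERED stub (= `HJLGap → Transport` of the skeleton, fully expanded): so
  `det (Γ₅ D_W(U,−δ,1)) ≠ 0` and, by the spectral flow inequality `negCount_sub_negCount_le_realModes` (levels of
  `Γ₅ D_W(U,m,1)` cross zero only at `m = −μ` for real modes `μ`), the negative count of `Γ₅ D_W(U,−δ,1)` equals
  that of `Γ₅ D_W(U,−1,1)`.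

Supports stmt-QuantumFields-8967.  No named facts, no `sorry`; axioms standard.

References: P. Hernández, K. Jansen, M. Lüscher, Nucl. Phys. B 552 (1999) 363 [hep-lat/9808010], (2.15)–(2.16);
R. G. Edwards, U. M. Heller, R. Narayanan, Nucl. Phys. B 535 (1998) 403 (level crossings ⟺ real modes).
-/

noncomputable section

namespace Summit.QuantumFields.QCD.Cruxes.TipPricing.HermitianFlowCoarea

open scoped BigOperators Topology Classical MeasureTheory Matrix ComplexConjugate
open Filter MeasureTheory Matrix
open Literature.MathematicalPhysics.QuantumLattice Literature.MathematicalPhysics.QuantumFieldTheory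
  Literature.Probability.LatticeModels
open Summit.QuantumFields.QCD.Theorems.ExtinctionBuildsQCD.Negative
open Summit.QuantumFields.QCD.Theorems.WindowExtinction.Negative
open Summit.QuantumFields.QCD.Cruxes.WindowExtinction.FreeVolumeHeavyWitness (fluxHJL_wilsonDirac_neg_eq)

/-- **Injectivity of `D_W(U,−δ,1)` under the HJL gap.**  If the gap
`(1 − 30ε) Σ_i ‖ψ_i‖² ≤ Σ_i ‖(D_W(U,−1,1)ψ)_i‖²` holds for every `ε`-norm-admissible `SU(3)` field on every periodic
four-torus, `U` is `ε`-norm-admissible, `0 < lo`, `30ε < lo²`, and `δ ∈ [lo, 1]`, then `D_W(U,−δ,1)ψ = 0` forces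
`ψ = 0`: the kernel equation reads `D_W(U,−1,1)ψ = (δ − 1)ψ`, so the gap
`(1 − 30ε)‖ψ‖² ≤ ‖D_W(U,−1,1)ψ‖² = (1 − δ)²‖ψ‖²` contradicts `(1 − δ)² ≤ 1 − lo < 1 − 30ε`.
(Port of 8964's `fluxHJL_mulVec_eq_zero`.) -/
theorem transportGap_mulVec_eq_zero {L : ℕ} [NeZero L] (U : GaugeConfig 4 L SU3) {ε lo : ℝ}
    (hG : ∀ {L : ℕ} [NeZero L] (U : GaugeConfig 4 L SU3) (ε : ℝ), IsNormAdmissible (fundamentalRep (Fin 3)) U ε →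
      ∀ ψ : TorusSite 4 L × Fin 3 × Fin 4 → ℂ,
        (1 - 30 * ε) * ∑ i, ‖ψ i‖ ^ 2 ≤ ∑ i, ‖(wilsonDirac (fundamentalRep (Fin 3)) U (-1) 1 *ᵥ ψ) i‖ ^ 2)
    (hadm : IsNormAdmissible (fundamentalRep (Fin 3)) U ε)
    (hlo : 0 < lo) (hε : 30 * ε < lo ^ 2) {δ : ℝ} (hloδ : lo ≤ δ) (hδ1 : δ ≤ 1)
    {ψ : TorusSite 4 L × Fin 3 × Fin 4 → ℂ}
    (hψ : wilsonDirac (fundamentalRep (Fin 3)) U (-δ) 1 *ᵥ ψ = 0) : ψ = 0 := by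
  by_contra hne
  -- the kernel equation at mass `−1`
  have hker : wilsonDirac (fundamentalRep (Fin 3)) U (-1) 1 *ᵥ ψ = ((δ - 1 : ℝ) : ℂ) • ψ := by
    have h := hψ
    rw [fluxHJL_wilsonDirac_neg_eq U δ, add_mulVec, smul_mulVec, one_mulVec,
      add_eq_zero_iff_eq_neg, ← neg_smul] at h
    rw [h]
    congr 1
    push_cast
    ring
  -- the HJL gap on `ψ`
  have hgap := hG U ε hadm ψ
  rw [hker, sum_norm_sq_smul, Complex.norm_real, Real.norm_eq_abs, sq_abs] at hgap
  have hS : 0 < ∑ i, ‖ψ i‖ ^ 2 := sum_norm_sq_pos hne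
  have h1 : 1 - 30 * ε ≤ (δ - 1) ^ 2 := le_of_mul_le_mul_right hgap hS
  have h2 : (δ - 1) ^ 2 ≤ 1 - δ := by nlinarith
  have h3 : lo ^ 2 ≤ lo := by nlinarith
  linarith

/-- **No real modes of the massless operator in `[lo, 1]`.**  Under the same hypotheses, no characteristic root
`μ` of `D_W(U,0,1)` has `Im μ = 0` and `lo ≤ Re μ ≤ 1`: its eigenvector would lie in the kernel of
`D_W(U,−Re μ,1) = D_W(U,0,1) − (Re μ)·1`.  (Port of 8964's `fluxHJL_no_realMode`.) -/
theorem transportGap_no_realMode {L : ℕ} [NeZero L] (U : GaugeConfig 4 L SU3) {ε lo : ℝ}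
    (hG : ∀ {L : ℕ} [NeZero L] (U : GaugeConfig 4 L SU3) (ε : ℝ), IsNormAdmissible (fundamentalRep (Fin 3)) U ε →
      ∀ ψ : TorusSite 4 L × Fin 3 × Fin 4 → ℂ,
        (1 - 30 * ε) * ∑ i, ‖ψ i‖ ^ 2 ≤ ∑ i, ‖(wilsonDirac (fundamentalRep (Fin 3)) U (-1) 1 *ᵥ ψ) i‖ ^ 2)
    (hadm : IsNormAdmissible (fundamentalRep (Fin 3)) U ε)
    (hlo : 0 < lo) (hε : 30 * ε < lo ^ 2) {μ : ℂ}
    (hμ : μ ∈ (wilsonDirac (fundamentalRep (Fin 3)) U 0 1).charpoly.roots) (him : μ.im = 0)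
    (hlo' : lo ≤ μ.re) (h1 : μ.re ≤ 1) : False := by
  have hρ : ∀ g : SU3, fundamentalRep (Fin 3) g ∈ Matrix.unitaryGroup (Fin 3) ℂ :=
    fundamentalRep_mem_unitaryGroup
  obtain ⟨v, hv, hDv⟩ := exists_eigenvector_of_mem_roots_charpoly _ hμ
  have hreal : ((μ.re : ℝ) : ℂ) = μ := Complex.ext (by simp) (by simp [him])
  have hker : wilsonDirac (fundamentalRep (Fin 3)) U (-μ.re) 1 *ᵥ v = 0 := by
    rw [wilsonDirac_eq_add_mass _ hρ U (-μ.re), add_mulVec, smul_mulVec, one_mulVec,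
      hDv, ← add_smul, Complex.ofReal_neg, hreal, add_neg_cancel, zero_smul]
  exact hv (transportGap_mulVec_eq_zero U hG hadm hlo hε hlo' h1 hker)

/-- **STUB T1 · `stub_transportOfGap`** (registered signature, line `hermitian-flow-coarea` r6; = `HJLGap → Transport`
of the skeleton, fully expanded).  Assume the Hernández–Jansen–Lüscher gap (2.16) for the `SU(3)` fundamental
representation: on every periodic four-torus, for every `ε`-norm-admissible field and every `ψ`,
`(1 − 30ε) Σ_i ‖ψ_i‖² ≤ Σ_i ‖(D_W(U,−1,1)ψ)_i‖²`.  Then for every periodic four-torus, every `ε`-norm-admissible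
`SU(3)` field `U`, and `0 < lo` with `30ε < lo²`: for all `δ ∈ [lo, 1]` the Hermitian Wilson–Dirac operator
`Γ₅ D_W(U,−δ,1)` is nonsingular and has the same number of negative characteristic roots as `Γ₅ D_W(U,−1,1)`.
Proof: `D_W(U,−δ,1)` is injective (`transportGap_mulVec_eq_zero`), so its determinant and that of `Γ₅ D_W`
(`Γ₅² = 1`) are nonzero; the spectral flow inequality `negCount_sub_negCount_le_realModes` bounds the change of the
negative count between `m = −1` and `m = −δ` by the number of real modes of `D_W(U,0,1)` in `[δ, 1]`, which is zero
(`transportGap_no_realMode`).  (Port of 8964's `flux_transport_of_HJL` over the proved gap.) -/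
theorem stub_transportOfGap :
    (∀ {L : ℕ} [NeZero L] (U : GaugeConfig 4 L SU3) (ε : ℝ), IsNormAdmissible (fundamentalRep (Fin 3)) U ε →
      ∀ ψ : TorusSite 4 L × Fin 3 × Fin 4 → ℂ,
        (1 - 30 * ε) * ∑ i, ‖ψ i‖ ^ 2 ≤ ∑ i, ‖(wilsonDirac (fundamentalRep (Fin 3)) U (-1) 1 *ᵥ ψ) i‖ ^ 2) →
    ∀ (L : ℕ) [NeZero L] (U : GaugeConfig 4 L SU3) (ε lo : ℝ),
      IsNormAdmissible (fundamentalRep (Fin 3)) U ε → 0 < lo → 30 * ε < lo ^ 2 →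
      ∀ δ : ℝ, lo ≤ δ → δ ≤ 1 →
        (spinorLift gammaFive * wilsonDirac (fundamentalRep (Fin 3)) U (-δ) 1).det ≠ 0 ∧
        (spinorLift gammaFive * wilsonDirac (fundamentalRep (Fin 3)) U (-δ) 1).charpoly.roots.countP
            (fun z : ℂ => z.re < 0) =
          (spinorLift gammaFive * wilsonDirac (fundamentalRep (Fin 3)) U (-1) 1).charpoly.roots.countP
            (fun z : ℂ => z.re < 0) := by
  intro hG L _ U ε lo hadm hlo hε δ hloδ hδ1
  have hρ : ∀ g : SU3, fundamentalRep (Fin 3) g ∈ Matrix.unitaryGroup (Fin 3) ℂ :=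
    fundamentalRep_mem_unitaryGroup
  refine ⟨?_, ?_⟩
  · -- nonsingularity
    rw [det_mul]
    refine mul_ne_zero ?_ ?_
    · have h := congrArg Matrix.det
        (spinorLift_gammaFive_mul_self (L := L) (N := 3))
      rw [det_mul, det_one] at h
      exact left_ne_zero_of_mul_eq_one h
    · intro hdet
      obtain ⟨v, hv, hv0⟩ := Matrix.exists_mulVec_eq_zero_iff.2 hdet
      exact hv (transportGap_mulVec_eq_zero U hG hadm hlo hε hloδ hδ1 hv0)
  · -- transport of the negative count
    have hflow := negCount_sub_negCount_le_realModes (fundamentalRep (Fin 3)) hρ U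
      (show (-1 : ℝ) ≤ -δ by linarith)
    have hzero : (wilsonDirac (fundamentalRep (Fin 3)) U 0 1).charpoly.roots.countP
        (fun μ : ℂ => μ.im = 0 ∧ (-1 : ℝ) ≤ -μ.re ∧ -μ.re ≤ -δ) = 0 := by
      rw [Multiset.countP_eq_zero]
      rintro μ hμ ⟨him, h1, h2⟩
      exact transportGap_no_realMode U hG hadm hlo hε hμ him (by linarith) (by linarith)
    rw [hzero, Nat.cast_zero] at hflow
    have h := abs_nonpos_iff.1 hflow
    rw [sub_eq_zero] at h
    exact_mod_cast h.symm

end Summit.QuantumFields.QCD.Cruxes.TipPricing.HermitianFlowCoarea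

end
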